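import Summits.Ventures.Crystal3D.Theorems.StickyWulffConstantTextureLiminfTexShadowColumnWordAffine
import Summits.Ventures.Crystal3D.Theorems.StickyWulffConstantTextureLiminfTexShadowColumnWordReduce
import Summits.Ventures.Crystal3D.Theorems.StickyWulffConstantGenericWallFloorStackWalkStarExclusion
import HarnessLib

/-!
# The column word lemma, III: THE COLUMN THEOREM — a chain of affine twin steps from plate 1's affine lattice that ends on plate 2's
# affine lattice spells the reduced relating word, letter by letter, at located balls (input (I5) = (P3)/(L4) of the terrace census,
# cf-p1 RULINGS (ccxxxv)(iii), (ccxli); lane T `TexShadow`, registered stub `stub_terraceCensus`, crux `TextureLiminfV5`)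

HONEST FRAMING. Venture `Summits/Ventures/Crystal3D` (cell `crystal3d-full`), route `route-Ventures-StickyWulffConstant`, helper
`--supports` the law-v5 crux `TextureLiminfV5` (stmt-Ventures-23912), lane T, mechanism (β); owner of input (I5) `stub_columnWord`:
19480-p2 g15.  Census-free lattice algebra assembling …ColumnWordAffine (affine twin steps, mod-3 law, plate matching) and …ColumnWordReduce
(letters, free reduction, scattered subword); clean import closure (RULING (ccxxxix) probe).  Nothing about configurations; F-C1 not moved.

THE SETTING (how the (β) assembly presents a saturated column).  Sequences `A : ℕ → frame`, `t b n : ℕ → E3` and `m : ℕ`: lamella `ℓ` is the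
affine lattice `(A ℓ · + t ℓ)''Λ₀`; it is left across the coherent twin plane through the ball `b ℓ` (a point of lamella `ℓ`) with unit normal
`n ℓ`, a MENU normal of `A ℓ`; the next lamella is the mirror image: `A (ℓ+1) = twinFrame (A ℓ) (n ℓ)`, `t (ℓ+1) = t ℓ + 2⟪b ℓ − t ℓ, n ℓ⟫ n ℓ`
(`image_reflect_affLat`).  Plate 1 is lamella `0`; the column ENDS ON PLATE 2 when lamella `m` contains a plate-2 ball together with its dozen
(`affLat_eq_of_dozen_subset` ⇒ lamella `m` IS plate 2's affine lattice).
* `exists_letterWord`, `wordFrame_eq_wordIso_trans`, `isChain_ne_of_forall₂` — DICTIONARY between the census's model words `κ : List E3`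
  (`CensusDominatedAt`: `A₂·Λ₀ = (wordFrame A₁ κ)·Λ₀`, letters unit model menu normals at `±1/3`) and letter words `w : List (Fin 4)`
  (`κ = ±nrmVec ∘ w` letterwise, `wordFrame B κ = (wordIso w).trans B`, `w` reduced);
* `reduce_colWord_eq` — **THE WORD**: if lamella `m`'s linear lattice is `(wordFrame (A 0) κ)·Λ₀` for a reduced admissible model word `κ`
  (letter word `w`), the column word reduces to `w`: `reduce ((List.range m).map i).reverse = w` (slot-dozen rigidity `ReflWord.image_fccSlots_eq_iff`);
* **`letters_realised_in_order`** — hence the letters of `κ` are crossed IN ORDER at steps `p 0 > p 1 > … ` (most recent first), the `j`-th at the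
  located ball `b (p j)` across the plane with spatial normal `n (p j) = ± (wordFrame (A 0) (κ.drop (j+1))) κ[j]` — the `j`-th twin plane of
  the pair EXACTLY as the census weight `censusSum` reads it; all other crossings come in cancelling pairs;
* `origin_eq_sum`, `exists_int_coeffs` — the TRANSLATION bookkeeping `t m = t 0 + Σ_{ℓ<m} 2 j_ℓ √(2/3)·n ℓ` with integer layer indices `j_ℓ`,
  and `sub_origin_mem_of_affLat_eq` — plate matching pins the class: `u₂ − t m ∈ A₂·Λ₀`.
WHAT THIS IS NOT: the configuration-level Def of (I5) (typed against the level-ledger vocabulary) or any census; F-C1 not moved.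
-/

noncomputable section

open scoped BigOperators

namespace Summit.Ventures.Crystal3D.Theorems

namespace ColumnWord

open Summit.Ventures.Crystal3D ReflWord
open Summit.Ventures.Crystal3D.Cruxes.TextureLiminf.TexShadow (E3 fccRef)
open Literature.MathematicalPhysics.StatisticalMechanics (fccStacking)
open scoped InnerProductSpace

/-! ### Dictionary: model words `List E3` vs letter words `List (Fin 4)` -/

/-- Every word of unit model menu normals is, letterwise, `± nrmVec` of a letter word. -/
theorem exists_letterWord : ∀ (κ : List E3),
    (∀ μ ∈ κ, ‖μ‖ = 1 ∧ ∀ w ∈ fccSlots, ⟪w, μ⟫_ℝ = 0 ∨ ⟪w, μ⟫_ℝ = Real.sqrt (2 / 3) ∨ ⟪w, μ⟫_ℝ = -Real.sqrt (2 / 3)) →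
      ∃ w : List (Fin 4), List.Forall₂ (fun μ a => μ = nrmVec a ∨ μ = -nrmVec a) κ w
  | [], _ => ⟨[], List.Forall₂.nil⟩
  | μ :: κ, hκ => by
    obtain ⟨w, hw⟩ := exists_letterWord κ fun μ' h => hκ μ' (List.mem_cons_of_mem μ h)
    obtain ⟨a, ha⟩ := exists_nrmVec_of_menu (hκ μ (by simp)).1 (hκ μ (by simp)).2
    exact ⟨a :: w, List.Forall₂.cons ha hw⟩

/-- `wordFrame B κ = (wordIso w).trans B` when `κ = ±nrmVec ∘ w` letterwise. -/
theorem wordFrame_eq_wordIso_trans (B : E3 ≃ₗᵢ[ℝ] E3) {κ : List E3} {w : List (Fin 4)}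
    (h : List.Forall₂ (fun μ a => μ = nrmVec a ∨ μ = -nrmVec a) κ w) : wordFrame B κ = (wordIso w).trans B := by
  induction h with
  | nil => rw [wordIso_nil, LinearIsometryEquiv.refl_trans]; rfl
  | cons hμ _ ih => rw [wordFrame_cons, reflection_eq_letterIso hμ, ih, LinearIsometryEquiv.trans_assoc, ← wordIso_cons]

/-- Letterwise `±nrmVec` correspondence passes to `drop`. -/
theorem forall₂_drop {κ : List E3} {w : List (Fin 4)} (h : List.Forall₂ (fun μ a => μ = nrmVec a ∨ μ = -nrmVec a) κ w) :
    ∀ j : ℕ, List.Forall₂ (fun μ a => μ = nrmVec a ∨ μ = -nrmVec a) (κ.drop j) (w.drop j) := by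
  intro j
  induction h generalizing j with
  | nil => rw [List.drop_nil, List.drop_nil]; exact List.Forall₂.nil
  | cons hμ hrest ih =>
    rcases j with _ | j
    · exact List.Forall₂.cons hμ hrest
    · exact ih j

/-- A reduced admissible model word (consecutive letters at `±1/3`) has a REDUCED letter word (no two equal neighbours). -/
theorem isChain_ne_of_forall₂ : ∀ {κ : List E3} {w : List (Fin 4)},
    List.Forall₂ (fun μ a => μ = nrmVec a ∨ μ = -nrmVec a) κ w →
      List.IsChain (fun μ μ' => ⟪μ, μ'⟫_ℝ = 1 / 3 ∨ ⟪μ, μ'⟫_ℝ = -1 / 3) κ → w.IsChain (· ≠ ·)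
  | [], _, h, _ => by cases h; exact List.IsChain.nil
  | [μ], _, h, _ => by
    cases h with
    | cons _ h' => cases h'; exact List.IsChain.singleton _
  | μ :: μ' :: κ, _, h, hc => by
    cases h with
    | cons hμ h' =>
      cases h' with
      | cons hμ' h'' =>
        cases hc with
        | cons_cons hr hc' =>
          refine List.IsChain.cons_cons ?_ (isChain_ne_of_forall₂ (List.Forall₂.cons hμ' h'') hc')
          rintro rfl
          have hs : ∀ c : Fin 4, ⟪nrmVec c, nrmVec c⟫_ℝ = 1 := fun c => by
            rw [real_inner_self_eq_norm_sq, norm_nrmVec, one_pow]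
          have h1 : ⟪μ, μ'⟫_ℝ = 1 ∨ ⟪μ, μ'⟫_ℝ = -1 := by
            rcases hμ with rfl | rfl <;> rcases hμ' with rfl | rfl
            · exact Or.inl (hs _)
            · exact Or.inr (by rw [inner_neg_right, hs])
            · exact Or.inr (by rw [inner_neg_left, hs])
            · exact Or.inl (by rw [inner_neg_left, inner_neg_right, neg_neg, hs])
          rcases hr with hr | hr <;> rcases h1 with h1 | h1 <;> rw [h1] at hr <;> norm_num at hr

/-! ### The column word -/

/-- **THE WORD OF A COLUMN IS THE RELATING WORD.**  Along a chain of twin steps (`A (ℓ+1) = twinFrame (A ℓ) (n ℓ)`, letters `i`), if the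
final frame's lattice is `(wordFrame (A 0) κ)·Λ₀` for a reduced admissible model word `κ` with letter word `w`, then the column word reduces
to `w`. -/
theorem reduce_colWord_eq {A : ℕ → (E3 ≃ₗᵢ[ℝ] E3)} {n : ℕ → E3} {i : ℕ → Fin 4} {m : ℕ}
    (hstep : ∀ ℓ < m, A (ℓ + 1) = twinFrame (A ℓ) (n ℓ))
    (hi : ∀ ℓ < m, n ℓ = A ℓ (nrmVec (i ℓ)) ∨ n ℓ = -A ℓ (nrmVec (i ℓ)))
    {κ : List E3} {w : List (Fin 4)} (hκw : List.Forall₂ (fun μ a => μ = nrmVec a ∨ μ = -nrmVec a) κ w)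
    (hκc : List.IsChain (fun μ μ' => ⟪μ, μ'⟫_ℝ = 1 / 3 ∨ ⟪μ, μ'⟫_ℝ = -1 / 3) κ)
    (hplate : A m '' fccRef = (wordFrame (A 0) κ) '' fccRef) :
    reduce ((List.range m).map i).reverse = w := by
  rw [frame_eq_wordIso_trans hstep hi, wordFrame_eq_wordIso_trans (A 0) hκw] at hplate
  have h1 : wordIso ((List.range m).map i).reverse '' fccStacking 1 (Real.sqrt (2 / 3)) =
      wordIso w '' fccStacking 1 (Real.sqrt (2 / 3)) := by
    have e : ∀ V : E3 ≃ₗᵢ[ℝ] E3, (V.trans (A 0)) '' fccRef = A 0 '' (V '' fccStacking 1 (Real.sqrt (2 / 3))) := by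
      intro V; rw [LinearIsometryEquiv.coe_trans, Set.image_comp]; rfl
    rw [e, e] at hplate
    exact (Set.image_eq_image (A 0).injective).1 hplate
  have h2 := image_fccSlots_eq_of_image_fcc_eq _ _ h1
  rw [← reduce_eq_self (isChain_ne_of_forall₂ hκw hκc)]
  exact (image_fccSlots_eq_iff _ _).1 h2

/-- **THE LETTERS OF THE RELATING WORD ARE CROSSED IN ORDER, AT LOCATED STEPS, ACROSS THE EXPECTED PLANES.**  In the setting of
`reduce_colWord_eq` (`κ` most recent letter first): there are steps `p 0 > p 1 > ⋯ > p (|κ|−1)`, all `< m`, such that at step `p j` the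
frame is `wordFrame (A 0) (κ.drop (j+1))` (the word frame of the letters crossed EARLIER) and the crossed plane's unit normal is `± A (p j) μ_j`
for the `j`-th letter `μ_j` of `κ` (`κ.drop j = μ_j :: κ.drop (j+1)`) — the `j`-th twin plane of the pair exactly as `censusSum` reads it;
every other crossing of the column belongs to a cancelling pair. -/
theorem letters_realised_in_order {A : ℕ → (E3 ≃ₗᵢ[ℝ] E3)} {n : ℕ → E3} {i : ℕ → Fin 4} {m : ℕ}
    (hstep : ∀ ℓ < m, A (ℓ + 1) = twinFrame (A ℓ) (n ℓ))
    (hi : ∀ ℓ < m, n ℓ = A ℓ (nrmVec (i ℓ)) ∨ n ℓ = -A ℓ (nrmVec (i ℓ)))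
    {κ : List E3} {w : List (Fin 4)} (hκw : List.Forall₂ (fun μ a => μ = nrmVec a ∨ μ = -nrmVec a) κ w)
    (hκc : List.IsChain (fun μ μ' => ⟪μ, μ'⟫_ℝ = 1 / 3 ∨ ⟪μ, μ'⟫_ℝ = -1 / 3) κ)
    (hplate : A m '' fccRef = (wordFrame (A 0) κ) '' fccRef) :
    ∃ p : ℕ → ℕ,
      (∀ j < κ.length, p j < m ∧ i (p j) :: w.drop (j + 1) = w.drop j ∧
        A (p j) = wordFrame (A 0) (κ.drop (j + 1)) ∧
        ∃ μ : E3, κ.drop j = μ :: κ.drop (j + 1) ∧ (n (p j) = A (p j) μ ∨ n (p j) = -A (p j) μ)) ∧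
      ∀ j j', j < j' → j' < κ.length → p j' < p j := by
  have hred := reduce_colWord_eq hstep hi hκw hκc hplate
  have hlen : κ.length = w.length := hκw.length_eq
  obtain ⟨p, hp, hmono⟩ := exists_positions_of_reduce_eq i w m hred
  refine ⟨p, fun j hj => ?_, fun j j' hjj' hj' => hmono j j' hjj' (hlen ▸ hj')⟩
  obtain ⟨hpm, hdrop, hredj⟩ := hp j (hlen ▸ hj)
  -- the frame at step `p j` is the word frame of the letters crossed earlier
  have hA : A (p j) = wordFrame (A 0) (κ.drop (j + 1)) := by
    rw [wordFrame_eq_wordIso_trans (A 0) (forall₂_drop hκw (j + 1)),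
      frame_eq_wordIso_trans (fun k hk => hstep k (hk.trans hpm)) (fun k hk => hi k (hk.trans hpm)), ← wordIso_reduce, hredj]
  -- the letter at step `p j` is the `j`-th letter of `κ` up to sign
  have hd := forall₂_drop hκw j
  rw [hdrop] at hd
  rcases hκd : κ.drop j with _ | ⟨μ, rest⟩
  · rw [hκd] at hd; cases hd
  · rw [hκd] at hd
    cases hd with
    | cons hμ hrest =>
      have hrest' : rest = κ.drop (j + 1) := by
        rw [← List.tail_drop, hκd]; rfl
      refine ⟨hpm, hdrop.symm, hA, μ, by rw [hrest'], ?_⟩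
      rcases hi (p j) hpm with h | h <;> rcases hμ with rfl | rfl
      · exact Or.inl h
      · exact Or.inr (by rw [map_neg, neg_neg]; exact h)
      · exact Or.inr h
      · exact Or.inl (by rw [map_neg]; exact h)

/-! ### Translation bookkeeping and plate matching -/

/-- The origin after `m` steps: `t m = t 0 + Σ_{ℓ<m} 2⟪b ℓ − t ℓ, n ℓ⟫ · n ℓ`. -/
theorem origin_eq_sum {t b n : ℕ → E3} :
    ∀ {m : ℕ}, (∀ ℓ < m, t (ℓ + 1) = t ℓ + (2 * ⟪b ℓ - t ℓ, n ℓ⟫_ℝ) • n ℓ) →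
      t m = t 0 + ∑ ℓ ∈ Finset.range m, (2 * ⟪b ℓ - t ℓ, n ℓ⟫_ℝ) • n ℓ
  | 0, _ => by simp
  | m + 1, h => by
    rw [Finset.sum_range_succ, h m (Nat.lt_succ_self m),
      origin_eq_sum (m := m) (fun ℓ hℓ => h ℓ (Nat.lt_succ_of_lt hℓ)), add_assoc]

/-- **Integer layer indices**: along the chain every coefficient is `2 j_ℓ √(2/3)` with `j_ℓ : ℤ` (the mirror ball `b ℓ` is a point of
lamella `ℓ` and `n ℓ` is a menu normal of its frame), so `t m = t 0 + Σ_{ℓ<m} 2 j_ℓ √(2/3) · n ℓ`. -/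
theorem exists_int_coeffs {A : ℕ → (E3 ≃ₗᵢ[ℝ] E3)} {t b n : ℕ → E3} {m : ℕ}
    (hstep : ∀ ℓ < m, t (ℓ + 1) = t ℓ + (2 * ⟪b ℓ - t ℓ, n ℓ⟫_ℝ) • n ℓ)
    (hmenu : ∀ ℓ < m, ∀ w ∈ fccSlots, ⟪A ℓ w, n ℓ⟫_ℝ = 0 ∨ ⟪A ℓ w, n ℓ⟫_ℝ = Real.sqrt (2 / 3) ∨ ⟪A ℓ w, n ℓ⟫_ℝ = -Real.sqrt (2 / 3))
    (hb : ∀ ℓ < m, b ℓ ∈ (fun r => A ℓ r + t ℓ) '' fccRef) :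
    ∃ j : ℕ → ℤ, (∀ ℓ < m, ⟪b ℓ - t ℓ, n ℓ⟫_ℝ = j ℓ * Real.sqrt (2 / 3)) ∧
      t m = t 0 + ∑ ℓ ∈ Finset.range m, ((2 * j ℓ : ℝ) * Real.sqrt (2 / 3)) • n ℓ := by
  have key : ∀ ℓ, ℓ < m → ∃ jℓ : ℤ, ⟪b ℓ - t ℓ, n ℓ⟫_ℝ = jℓ * Real.sqrt (2 / 3) :=
    fun ℓ hℓ => exists_int_inner_sub_origin (hmenu ℓ hℓ) (hb ℓ hℓ)
  choose! j hj using key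
  refine ⟨j, hj, ?_⟩
  rw [origin_eq_sum hstep]
  congr 1
  refine Finset.sum_congr rfl fun ℓ hℓ => ?_
  rw [hj ℓ (Finset.mem_range.1 hℓ), mul_assoc]

/-- **PLATE MATCHING at the top of the column.**  If lamella `m` contains a ball `x` of the affine lattice `(B· + s)''Λ₀` (plate 2's) together
with its dozen `x + A m w`, `w ∈ fccSlots`, then lamella `m` IS that affine lattice: same linear lattice and `s − t m ∈ B·Λ₀`. -/
theorem plate_matching {A : ℕ → (E3 ≃ₗᵢ[ℝ] E3)} {t : ℕ → E3} {m : ℕ} {B : E3 ≃ₗᵢ[ℝ] E3} {s x : E3}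
    (hxA : x ∈ (fun r => A m r + t m) '' fccRef) (hxB : x ∈ (fun r => B r + s) '' fccRef)
    (hdoz : ∀ w ∈ fccSlots, x + A m w ∈ (fun r => B r + s) '' fccRef) :
    (fun r => A m r + t m) '' fccRef = (fun r => B r + s) '' fccRef ∧ A m '' fccRef = B '' fccRef ∧ s - t m ∈ B '' fccRef := by
  have h := affLat_eq_of_dozen_subset hxA hxB hdoz
  obtain ⟨hlin, hst⟩ := (affLat_eq_iff _ _ _ _).1 h
  exact ⟨h, hlin, hlin ▸ hst⟩

/-! ### The column theorem, packaged -/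

/-- **THE COLUMN THEOREM (input (I5), algebraic form).**  A chain of coherent twin steps starting from the affine lattice `(A 0 · + t 0)''Λ₀`
(plate 1's), crossing at each step `ℓ < m` the plane through the lattice ball `b ℓ` with unit menu normal `n ℓ` of the current frame, whose
last lamella contains a ball `x` of plate 2's affine lattice `(B· + s)''Λ₀` with its dozen, where plate 2's linear lattice is related to
plate 1's by the reduced admissible model word `κ` (`B·Λ₀ = (wordFrame (A 0) κ)·Λ₀`, the `CensusDominatedAt` currency):
(i) lamella `m` is plate 2's affine lattice; (ii) the letters of `κ` are crossed IN ORDER at steps `p 0 > ⋯ > p (|κ|−1)`, the `j`-th at the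
located ball `b (p j)` across the plane with unit normal `± (wordFrame (A 0) (κ.drop (j+1))) μ_j`; (iii) the origins satisfy
`t m = t 0 + Σ 2 j_ℓ √(2/3) n ℓ` with integer `j_ℓ` and `s − t m ∈ B·Λ₀`. -/
theorem column_theorem {A : ℕ → (E3 ≃ₗᵢ[ℝ] E3)} {t b n : ℕ → E3} {m : ℕ}
    (hA : ∀ ℓ < m, A (ℓ + 1) = twinFrame (A ℓ) (n ℓ))
    (ht : ∀ ℓ < m, t (ℓ + 1) = t ℓ + (2 * ⟪b ℓ - t ℓ, n ℓ⟫_ℝ) • n ℓ)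
    (hmenu : ∀ ℓ < m, ‖n ℓ‖ = 1 ∧
      ∀ w ∈ fccSlots, ⟪A ℓ w, n ℓ⟫_ℝ = 0 ∨ ⟪A ℓ w, n ℓ⟫_ℝ = Real.sqrt (2 / 3) ∨ ⟪A ℓ w, n ℓ⟫_ℝ = -Real.sqrt (2 / 3))
    (hb : ∀ ℓ < m, b ℓ ∈ (fun r => A ℓ r + t ℓ) '' fccRef)
    {B : E3 ≃ₗᵢ[ℝ] E3} {s x : E3} (hxA : x ∈ (fun r => A m r + t m) '' fccRef) (hxB : x ∈ (fun r => B r + s) '' fccRef)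
    (hdoz : ∀ w ∈ fccSlots, x + A m w ∈ (fun r => B r + s) '' fccRef)
    {κ : List E3} (hκ : ∀ μ ∈ κ, ‖μ‖ = 1 ∧ ∀ w ∈ fccSlots, ⟪w, μ⟫_ℝ = 0 ∨ ⟪w, μ⟫_ℝ = Real.sqrt (2 / 3) ∨ ⟪w, μ⟫_ℝ = -Real.sqrt (2 / 3))
    (hκc : List.IsChain (fun μ μ' => ⟪μ, μ'⟫_ℝ = 1 / 3 ∨ ⟪μ, μ'⟫_ℝ = -1 / 3) κ)
    (hrel : B '' fccRef = (wordFrame (A 0) κ) '' fccRef) :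
    (fun r => A m r + t m) '' fccRef = (fun r => B r + s) '' fccRef ∧
      (∃ p : ℕ → ℕ,
        (∀ j < κ.length, p j < m ∧ A (p j) = wordFrame (A 0) (κ.drop (j + 1)) ∧
          ∃ μ : E3, κ.drop j = μ :: κ.drop (j + 1) ∧ (n (p j) = A (p j) μ ∨ n (p j) = -A (p j) μ)) ∧
        ∀ j j', j < j' → j' < κ.length → p j' < p j) ∧
      (∃ j : ℕ → ℤ, (∀ ℓ < m, ⟪b ℓ - t ℓ, n ℓ⟫_ℝ = j ℓ * Real.sqrt (2 / 3)) ∧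
        t m = t 0 + ∑ ℓ ∈ Finset.range m, ((2 * j ℓ : ℝ) * Real.sqrt (2 / 3)) • n ℓ) ∧
      s - t m ∈ B '' fccRef := by
  obtain ⟨haff, hlin, hst⟩ := plate_matching hxA hxB hdoz
  obtain ⟨i, hi⟩ := exists_letters hmenu
  obtain ⟨w, hκw⟩ := exists_letterWord κ hκ
  obtain ⟨p, hp, hmono⟩ := letters_realised_in_order hA hi hκw hκc (hlin.trans hrel)
  exact ⟨haff, ⟨p, fun j hj => let ⟨h1, _, h3, h4⟩ := hp j hj; ⟨h1, h3, h4⟩, hmono⟩,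
    exists_int_coeffs ht (fun ℓ hℓ => (hmenu ℓ hℓ).2) hb, hst⟩

end ColumnWord

end Summit.Ventures.Crystal3D.Theorems

end
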